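import Mathlib
import HarnessLib
import Literature.NumberTheory.EllipticCurves.OpenImageMazurCharacterProofs
import Literature.NumberTheory.EllipticCurves.PAdicHeightsProofs

/-!
# Continuous `ℚ̄_p`-valued characters of `Γ_ℚ`: the `p`-adic balls argument

Support file for the proof of the crux `DeterminantParity` of the route
`EvenSkinnerWilesMirror` (item `stmt-Langlands-15311`).  For a character
`χ : Γ_ℚ →* (ℚ̄_p)ˣ` whose underlying function `g ↦ χ g ∈ ℚ̄_p` is continuous we prove:

* `eq_one_of_forall_inertia` — if `χ` is trivial on every inertia group, then `χ = 1`
  (Minkowski: `ℚ` has no non-trivial everywhere unramified abelian extension; here through the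
  finite-level statement `Mazur1978.monoidHom_eq_one_of_forall_inertia` applied to `χ` modulo the
  open balls `U_n = {u : ‖u - 1‖ < 2⁻ⁿ}`, `n ≥ 0`, which separate points);
* `exists_pow_eq_one_of_forall_inertia` — at a place `v ∤ p` the restriction of `χ` to the
  inertia groups above `v` has finite exponent (Kronecker–Weber at finite level,
  `Mazur1978.exists_comp_modNCyclotomicCharacter_eq`, the vanishing of `χ_d` on `I_ℓ` for `ℓ ∤ d`,
  and the ultrametric identity `‖x ^ N - 1‖ = ‖x - 1‖` for `‖x - 1‖ < 1`, `p ∤ N`, built on the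
  tree lemma `Literature.NumberTheory.EllipticCurves.norm_eq_one_of_norm_sub_one_lt`).

All statements are elementary consequences of class field theory for `ℚ` as already formalised
in the tree; no new facts and no new definitions are introduced (decomp-langlands lens-2, g29).
Ref: Serre, *Abelian ℓ-adic representations* (1968), Ch. III §1.1–§1.2 (locally algebraic
characters), Ch. I §1.2; Washington, *Cyclotomic Fields*, Thm. 14.1 (Kronecker–Weber).
-/

set_option linter.dupNamespace false -- project-wide option (lakefile weak.linter.dupNamespace); `Summit.Langlands.Langlands` is the mandated namespace

namespace Summit.Langlands.Langlands.Theorems.EvenSkinnerWilesMirrorDeterminantParity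

open Field NumberField IsDedekindDomain
open Literature.NumberTheory.GaloisRepresentations
open Literature.NumberTheory.EllipticCurves

/-! ## Ultrametric estimates around `1` -/

section Ultrametric

variable {K : Type*} [NormedField K]

/-- An element lying in all the balls `‖x - 1‖ < 2⁻ⁿ` equals `1`. [folklore] -/
theorem eq_one_of_forall_norm_sub_one_lt {x : K} (h : ∀ n : ℕ, ‖x - 1‖ < (2 : ℝ)⁻¹ ^ n) :
    x = 1 := by
  by_contra hx
  obtain ⟨n, hn⟩ := exists_pow_lt_of_lt_one (norm_pos_iff.mpr (sub_ne_zero.mpr hx))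
    (by norm_num : (2 : ℝ)⁻¹ < 1)
  exact lt_irrefl _ ((h n).trans hn)

variable [IsUltrametricDist K]

/-- In an ultrametric normed field, `‖∑_{i<n} x^i‖ ≤ 1` when `‖x‖ ≤ 1`. [folklore] -/
theorem norm_geom_sum_le_one {x : K} (hx : ‖x‖ ≤ 1) (n : ℕ) :
    ‖∑ i ∈ Finset.range n, x ^ i‖ ≤ 1 :=
  IsUltrametricDist.norm_sum_le_of_forall_le_of_nonneg zero_le_one fun i _ => by
    rw [norm_pow]; exact pow_le_one₀ (norm_nonneg _) hx

/-- `‖x ^ n - 1‖ ≤ ‖x - 1‖` for `‖x - 1‖ < 1` (ultrametric). [folklore] -/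
theorem norm_pow_sub_one_le {x : K} (hx : ‖x - 1‖ < 1) (n : ℕ) : ‖x ^ n - 1‖ ≤ ‖x - 1‖ := by
  rw [← geom_sum_mul, norm_mul]
  calc ‖∑ i ∈ Finset.range n, x ^ i‖ * ‖x - 1‖ ≤ 1 * ‖x - 1‖ :=
        mul_le_mul_of_nonneg_right
          (norm_geom_sum_le_one (norm_eq_one_of_norm_sub_one_lt hx).le n) (norm_nonneg _)
    _ = ‖x - 1‖ := one_mul _

/-- `‖1 + x + ⋯ + x^{n-1}‖ = 1` for `‖x - 1‖ < 1` and `‖n‖ = 1` (ultrametric). [folklore] -/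
theorem norm_geom_sum_eq_one {x : K} (hx : ‖x - 1‖ < 1) {n : ℕ} (hn : ‖(n : K)‖ = 1) :
    ‖∑ i ∈ Finset.range n, x ^ i‖ = 1 := by
  have hsum : ∑ i ∈ Finset.range n, x ^ i = (n : K) + ∑ i ∈ Finset.range n, (x ^ i - 1) := by
    rw [Finset.sum_sub_distrib, Finset.sum_const, Finset.card_range, nsmul_eq_mul, mul_one]
    ring
  have hs : ‖∑ i ∈ Finset.range n, (x ^ i - 1)‖ ≤ ‖x - 1‖ :=
    IsUltrametricDist.norm_sum_le_of_forall_le_of_nonneg (norm_nonneg _)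
      fun i _ => norm_pow_sub_one_le hx i
  rw [hsum, IsUltrametricDist.norm_add_eq_max_of_norm_ne_norm
      (by rw [hn]; exact (lt_of_le_of_lt hs hx).ne'), hn, max_eq_left ((hs.trans hx.le))]

/-- The key ultrametric identity: `‖x ^ n - 1‖ = ‖x - 1‖` for `‖x - 1‖ < 1` and `‖n‖ = 1`
(`n` a unit of the residue characteristic). [folklore] -/
theorem norm_pow_sub_one_eq {x : K} (hx : ‖x - 1‖ < 1) {n : ℕ} (hn : ‖(n : K)‖ = 1) :
    ‖x ^ n - 1‖ = ‖x - 1‖ := by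
  rw [← geom_sum_mul, norm_mul, norm_geom_sum_eq_one hx hn, one_mul]

/-- The ball `U_n = {u : ‖u - 1‖ < 2⁻ⁿ}` (`n ≥ 0`) is a subgroup of `Kˣ` (ultrametric
inequality); the neighbourhoods `U_n` of `1` separate points.  Stated as an existence so that the
proof files introduce no new definitions. [folklore] -/
theorem exists_subgroup_ball (n : ℕ) :
    ∃ U : Subgroup Kˣ, ∀ u : Kˣ, u ∈ U ↔ ‖(u : K) - 1‖ < (2 : ℝ)⁻¹ ^ n := by
  refine ⟨{ carrier := {u | ‖(u : K) - 1‖ < (2 : ℝ)⁻¹ ^ n}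
            one_mem' := by simp
            mul_mem' := fun {a b} ha hb => ?_
            inv_mem' := fun {a} ha => ?_ }, fun _ => Iff.rfl⟩
  · have ha' : ‖(a : K) - 1‖ < (2 : ℝ)⁻¹ ^ n := ha
    have hb' : ‖(b : K) - 1‖ < (2 : ℝ)⁻¹ ^ n := hb
    have ha1 : ‖(a : K)‖ = 1 :=
      norm_eq_one_of_norm_sub_one_lt (lt_of_lt_of_le ha' (pow_le_one₀ (by norm_num) (by norm_num)))
    show ‖((a * b : Kˣ) : K) - 1‖ < (2 : ℝ)⁻¹ ^ n
    rw [Units.val_mul, show (a : K) * b - 1 = a * (b - 1) + (a - 1) by ring]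
    refine lt_of_le_of_lt (IsUltrametricDist.norm_add_le_max _ _) (max_lt ?_ ha')
    rw [norm_mul, ha1, one_mul]
    exact hb'
  · have ha' : ‖(a : K) - 1‖ < (2 : ℝ)⁻¹ ^ n := ha
    have ha1 : ‖((a⁻¹ : Kˣ) : K)‖ = 1 := by
      rw [Units.val_inv_eq_inv_val, norm_inv,
        norm_eq_one_of_norm_sub_one_lt (lt_of_lt_of_le ha' (pow_le_one₀ (by norm_num) (by norm_num))), inv_one]
    show ‖((a⁻¹ : Kˣ) : K) - 1‖ < (2 : ℝ)⁻¹ ^ n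
    rw [show ((a⁻¹ : Kˣ) : K) - 1 = (a⁻¹ : Kˣ) * (1 - (a : K)) by
      rw [mul_sub, mul_one, Units.inv_mul], norm_mul, ha1, one_mul, norm_sub_rev]
    exact ha'

end Ultrametric

/-! ## Continuous `ℚ̄_p^×`-valued characters of `Γ_ℚ` -/

section Character

variable {p : ℕ} [Fact p.Prime]

/-- For a character `χ` of `Γ_ℚ` with continuous underlying function, the composite
`Γ_ℚ → ℚ̄_pˣ → ℚ̄_pˣ/U` has open kernel when `U` is an open ball around `1`. [folklore] -/
theorem isOpen_ker_mk_comp {U : Subgroup (PadicAlgCl p)ˣ} {r : ℝ}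
    (hU : ∀ u : (PadicAlgCl p)ˣ, u ∈ U ↔ ‖(u : PadicAlgCl p) - 1‖ < r)
    (χ : absoluteGaloisGroup ℚ →* (PadicAlgCl p)ˣ)
    (hχ : Continuous fun g => (χ g : PadicAlgCl p)) :
    IsOpen ((((QuotientGroup.mk' U).comp χ).ker : Set (absoluteGaloisGroup ℚ))) := by
  have hset : ((((QuotientGroup.mk' U).comp χ).ker : Set (absoluteGaloisGroup ℚ))) =
      (fun g => (χ g : PadicAlgCl p)) ⁻¹' Metric.ball (1 : PadicAlgCl p) r := by
    ext g
    simp only [SetLike.mem_coe, MonoidHom.mem_ker, MonoidHom.coe_comp, Function.comp_apply,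
      QuotientGroup.mk'_apply, QuotientGroup.eq_one_iff, hU, Set.mem_preimage,
      Metric.mem_ball, dist_eq_norm]
  rw [hset]
  exact Metric.isOpen_ball.preimage hχ

/-- The composite `Γ_ℚ → ℚ̄_pˣ → ℚ̄_pˣ/U` vanishes at `g` iff `‖χ g - 1‖ < r`. [folklore] -/
theorem mk_comp_apply_eq_one_iff {U : Subgroup (PadicAlgCl p)ˣ} {r : ℝ}
    (hU : ∀ u : (PadicAlgCl p)ˣ, u ∈ U ↔ ‖(u : PadicAlgCl p) - 1‖ < r)
    (χ : absoluteGaloisGroup ℚ →* (PadicAlgCl p)ˣ) (g : absoluteGaloisGroup ℚ) :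
    ((QuotientGroup.mk' U).comp χ) g = 1 ↔ ‖(χ g : PadicAlgCl p) - 1‖ < r := by
  simp only [MonoidHom.coe_comp, Function.comp_apply, QuotientGroup.mk'_apply,
    QuotientGroup.eq_one_iff, hU]

/-- Finite-level Minkowski (`Mazur1978.monoidHom_eq_one_of_forall_inertia`) for the reduction of
a character modulo a subgroup `U`: if `χ` kills every inertia group and `χ mod U` has open
kernel, then `χ mod U` is trivial. [folklore] -/
theorem mk_comp_eq_one {G : Type*} [CommGroup G] (U : Subgroup G)
    (χ : absoluteGaloisGroup ℚ →* G)
    (hk : IsOpen ((((QuotientGroup.mk' U).comp χ).ker : Set (absoluteGaloisGroup ℚ))))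
    (hI : ∀ v : HeightOneSpectrum (𝓞 ℚ), ∀ 𝔓 ∈ v.primesAbove,
      ∀ τ ∈ 𝔓.inertia (absoluteGaloisGroup ℚ), χ τ = 1) :
    (QuotientGroup.mk' U).comp χ = 1 :=
  Mazur1978.monoidHom_eq_one_of_forall_inertia ((QuotientGroup.mk' U).comp χ) hk
    fun v 𝔓 h𝔓 τ hτ => (congrArg (QuotientGroup.mk' U) (hI v 𝔓 h𝔓 τ hτ)).trans (map_one _)

/-- Finite-level Kronecker–Weber (`Mazur1978.exists_comp_modNCyclotomicCharacter_eq`) for the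
reduction of a character modulo a subgroup `U`: if `χ mod U` has open kernel it factors through
some `χ_m : Γ_ℚ → (ℤ/m)ˣ`.  (Stated for a general commutative target so that no instance search
on the concrete quotient `ℚ̄_pˣ/U_n` is needed.) [folklore] -/
theorem exists_comp_mk {G : Type*} [CommGroup G] (U : Subgroup G)
    (χ : absoluteGaloisGroup ℚ →* G)
    (hk : IsOpen ((((QuotientGroup.mk' U).comp χ).ker : Set (absoluteGaloisGroup ℚ)))) :
    ∃ (m : ℕ) (_ : NeZero m) (β : (ZMod m)ˣ →* G ⧸ U),
      ∀ σ, β (modNCyclotomicCharacter ℚ m σ) = ((QuotientGroup.mk' U).comp χ) σ :=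
  Mazur1978.exists_comp_modNCyclotomicCharacter_eq _ hk

/-- **No everywhere-unramified `p`-adic characters of `Γ_ℚ`.**  A character
`χ : Γ_ℚ → ℚ̄_pˣ` with continuous underlying function which is trivial on the inertia group of
every prime of `ℤ̄` is trivial (Minkowski / Kronecker–Weber, through the finite-level statement
`Mazur1978.monoidHom_eq_one_of_forall_inertia` applied modulo the shrinking balls `U_n`).
Ref: Washington, *Cyclotomic Fields*, Thm. 14.1; Serre (1968), Ch. III §1. [folklore] -/
theorem eq_one_of_forall_inertia (χ : absoluteGaloisGroup ℚ →* (PadicAlgCl p)ˣ)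
    (hχ : Continuous fun g => (χ g : PadicAlgCl p))
    (hI : ∀ v : HeightOneSpectrum (𝓞 ℚ), ∀ 𝔓 ∈ v.primesAbove,
      ∀ τ ∈ 𝔓.inertia (absoluteGaloisGroup ℚ), χ τ = 1) :
    χ = 1 := by
  refine MonoidHom.ext fun g => ?_
  rw [MonoidHom.one_apply]
  refine Units.ext ?_
  rw [Units.val_one]
  refine eq_one_of_forall_norm_sub_one_lt fun n => ?_
  obtain ⟨U, hU⟩ := exists_subgroup_ball (K := PadicAlgCl p) n
  have hψ1 := mk_comp_eq_one U χ (isOpen_ker_mk_comp hU χ hχ) hI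
  have hg := DFunLike.congr_fun hψ1 g
  rw [MonoidHom.one_apply, mk_comp_apply_eq_one_iff hU] at hg
  exact hg

/-- Chinese remainder on units: for `m = a * b` with `a, b` coprime, a unit of `ZMod m` with
trivial images in `(ZMod a)ˣ` and `(ZMod b)ˣ` is trivial. [folklore] -/
theorem units_zmod_eq_one_of_unitsMap_eq_one {a b m : ℕ} [NeZero m] (hm : m = a * b)
    (hab : a.Coprime b) (z : (ZMod m)ˣ) (ha : ZMod.unitsMap (Dvd.intro _ hm.symm) z = 1)
    (hb : ZMod.unitsMap (Dvd.intro_left _ hm.symm) z = 1) : z = 1 := by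
  subst hm
  have hcast : ∀ {c : ℕ} (hc : c ∣ a * b), ZMod.unitsMap hc z = 1 →
      c ∣ ((z : ZMod (a * b)) - 1).val := by
    intro c hc h
    have h1 : (ZMod.castHom hc (ZMod c)) ((z : ZMod (a * b)) - 1) = 0 := by
      rw [map_sub, map_one, sub_eq_zero]
      have := congrArg (fun u : (ZMod c)ˣ => (u : ZMod c)) h
      simpa [ZMod.unitsMap_def] using this
    rw [← ZMod.natCast_zmod_val ((z : ZMod (a * b)) - 1), map_natCast] at h1
    exact (ZMod.natCast_eq_zero_iff _ _).mp h1
  have hm' : a * b ∣ ((z : ZMod (a * b)) - 1).val :=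
    hab.mul_dvd_of_dvd_of_dvd (hcast (Dvd.intro _ rfl) ha) (hcast (Dvd.intro_left _ rfl) hb)
  have h0 : ((z : ZMod (a * b)) - 1) = 0 := by
    rw [← ZMod.natCast_zmod_val ((z : ZMod (a * b)) - 1), ZMod.natCast_eq_zero_iff]
    exact hm'
  exact Units.ext (sub_eq_zero.mp h0)

/-- `φ(ℓ^e) ∣ (ℓ - 1) ℓ^e` for a prime `ℓ`. [folklore] -/
theorem totient_prime_pow_dvd {ℓ : ℕ} (hℓ : ℓ.Prime) (e : ℕ) :
    Nat.totient (ℓ ^ e) ∣ (ℓ - 1) * ℓ ^ e := by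
  rcases Nat.eq_zero_or_pos e with rfl | he
  · simp
  · rw [Nat.totient_prime_pow hℓ he]
    exact ⟨ℓ, by
      obtain ⟨e', rfl⟩ : ∃ e', e = e' + 1 := ⟨e - 1, by omega⟩
      rw [Nat.add_sub_cancel, pow_succ]; ring⟩

/-- On the inertia groups above a prime `ℓ`, the values of the level-`m` cyclotomic character
are killed by `(ℓ - 1) ℓ^{v_ℓ(m)}`: write `m = ℓ^e d` with `ℓ ∤ d`; the `d`-component of
`χ_m(τ)` is `χ_d(τ) = 1` (`I_ℓ` acts trivially on `μ_d`) and the `ℓ^e`-component has order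
dividing `φ(ℓ^e)`. [folklore] -/
theorem modNCyclotomicCharacter_pow_eq_one_of_mem_inertia {m ℓ e d : ℕ} [NeZero m]
    (hℓ : ℓ.Prime) (hm : m = ℓ ^ e * d) (hd : ¬ ℓ ∣ d) {v : HeightOneSpectrum (𝓞 ℚ)}
    (hv : (ℓ : 𝓞 ℚ) ∈ v.asIdeal) {𝔓 : Ideal (absIntegers (𝓞 ℚ) ℚ)}
    (h𝔓 : 𝔓 ∈ v.primesAbove) {τ : absoluteGaloisGroup ℚ}
    (hτ : τ ∈ 𝔓.inertia (absoluteGaloisGroup ℚ)) :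
    modNCyclotomicCharacter ℚ m τ ^ ((ℓ - 1) * ℓ ^ e) = 1 := by
  haveI : 𝔓.IsPrime := h𝔓.1
  have hd0 : d ≠ 0 := by rintro rfl; exact (NeZero.ne m) (by rw [hm, mul_zero])
  haveI : NeZero d := ⟨hd0⟩
  haveI : NeZero (ℓ ^ e) := ⟨pow_ne_zero _ hℓ.ne_zero⟩
  have hcop : (ℓ ^ e).Coprime d := (Nat.Coprime.pow_left _ ((Nat.Prime.coprime_iff_not_dvd hℓ).mpr hd))
  refine units_zmod_eq_one_of_unitsMap_eq_one hm hcop _ ?_ ?_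
  · -- the `ℓ^e`-component: order divides `φ(ℓ^e) ∣ (ℓ - 1) ℓ^e`
    obtain ⟨c, hc⟩ := totient_prime_pow_dvd hℓ e
    rw [map_pow, hc, pow_mul, ZMod.pow_totient, one_pow]
  · -- the `d`-component: `χ_d(τ) = 1` on `I_𝔓`, `𝔓 ∤ d`
    have hgen : Rat.HeightOneSpectrum.natGenerator v = ℓ :=
      (Nat.prime_dvd_prime_iff_eq (Rat.HeightOneSpectrum.prime_natGenerator v) hℓ).mp
        ((Rat.natCast_mem_asIdeal_iff v).mp hv)
    have hnd : ¬ ((Rat.HeightOneSpectrum.primesEquiv v : Nat.Primes) : ℕ) ∣ d := fun h =>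
      hd (hgen ▸ (h : Rat.HeightOneSpectrum.natGenerator v ∣ d))
    have hdτ : modNCyclotomicCharacter ℚ d τ = 1 :=
      modNCyclotomicCharacter_eq_one_of_mem_inertia
        (Rat.natCast_not_mem_of_mem_primesAbove_of_not_dvd h𝔓 hnd) hτ
    rw [map_pow, Mazur1978.unitsMap_modNCyclotomicCharacter, hdτ, one_pow]

/-- **Finite exponent on `ℓ`-adic inertia (`ℓ ≠ p`).**  For a character `χ : Γ_ℚ → ℚ̄_pˣ` with
continuous underlying function and a place `v ∤ p` of `ℚ`, some positive power of `χ` is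
trivial on every inertia group above `v`.  (Kronecker–Weber at the finite levels `χ mod U_n`:
`χ(τ)^{(ℓ-1)ℓ^{aₙ}} ∈ U_n`, and the exponents are made uniform in `n` by the ultrametric identity
`‖x^{ℓ^j} - 1‖ = ‖x - 1‖`.)
Ref: Serre (1968), Ch. III §1.1 and App. A.2; Washington, Thm. 14.1. [folklore] -/
theorem exists_pow_eq_one_of_forall_inertia (χ : absoluteGaloisGroup ℚ →* (PadicAlgCl p)ˣ)
    (hχ : Continuous fun g => (χ g : PadicAlgCl p)) {v : HeightOneSpectrum (𝓞 ℚ)}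
    (hv : (p : 𝓞 ℚ) ∉ v.asIdeal) :
    ∃ N : ℕ, 0 < N ∧ ∀ 𝔓 ∈ v.primesAbove, ∀ τ ∈ 𝔓.inertia (absoluteGaloisGroup ℚ),
      χ τ ^ N = 1 := by
  obtain ⟨ℓ, hℓdef⟩ : ∃ ℓ, Rat.HeightOneSpectrum.natGenerator v = ℓ := ⟨_, rfl⟩
  have hℓ : ℓ.Prime := hℓdef ▸ Rat.HeightOneSpectrum.prime_natGenerator v
  have hvℓ : (ℓ : 𝓞 ℚ) ∈ v.asIdeal := hℓdef ▸ Mazur1978.natCast_natGenerator_mem_asIdeal v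
  have hℓp : ℓ ≠ p := by
    rintro rfl
    exact hv hvℓ
  have hpℓ : ∀ j : ℕ, ‖((ℓ ^ j : ℕ) : PadicAlgCl p)‖ = 1 := fun j => by
    rw [← map_natCast (algebraMap ℚ_[p] (PadicAlgCl p)), PadicAlgCl.norm_extends,
      Padic.norm_natCast_eq_one_iff]
    exact Nat.Coprime.pow_right _ ((Nat.coprime_primes Fact.out hℓ).mpr hℓp.symm)
  -- at each level `n`: an exponent `e n` with `χ(τ)^{(ℓ-1)ℓ^{e n}} ∈ U_n` on inertia above `v`
  have hlevel : ∀ n : ℕ, ∃ e : ℕ, ∀ 𝔓 ∈ v.primesAbove, ∀ τ ∈ 𝔓.inertia (absoluteGaloisGroup ℚ),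
      ‖((χ τ ^ ((ℓ - 1) * ℓ ^ e) : (PadicAlgCl p)ˣ) : PadicAlgCl p) - 1‖ < (2 : ℝ)⁻¹ ^ n := by
    intro n
    obtain ⟨U, hU⟩ := exists_subgroup_ball (K := PadicAlgCl p) n
    obtain ⟨m, hm0, β, hβ⟩ := exists_comp_mk U χ (isOpen_ker_mk_comp hU χ hχ)
    obtain ⟨e, d, hd, hm⟩ := Nat.exists_eq_pow_mul_and_not_dvd (NeZero.ne m) ℓ hℓ.ne_one
    refine ⟨e, fun 𝔓 h𝔓 τ hτ => ?_⟩
    have h1 : ((QuotientGroup.mk' U).comp χ) (τ ^ ((ℓ - 1) * ℓ ^ e)) = 1 := by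
      rw [← hβ, map_pow, modNCyclotomicCharacter_pow_eq_one_of_mem_inertia hℓ hm hd hvℓ h𝔓 hτ,
        map_one]
    rw [mk_comp_apply_eq_one_iff hU, map_pow] at h1
    exact h1
  choose e he using hlevel
  refine ⟨(ℓ - 1) * ℓ ^ e 0, Nat.mul_pos (by have := hℓ.two_le; omega) (pow_pos hℓ.pos _),
    fun 𝔓 h𝔓 τ hτ => Units.ext ?_⟩
  rw [Units.val_one]
  -- `x = χ(τ)^{(ℓ-1)ℓ^{e 0}}` lies in every ball `U_n`
  refine eq_one_of_forall_norm_sub_one_lt fun n => ?_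
  have hx0 : ‖((χ τ ^ ((ℓ - 1) * ℓ ^ e 0) : (PadicAlgCl p)ˣ) : PadicAlgCl p) - 1‖ < 1 := by
    have h := he 0 𝔓 h𝔓 τ hτ
    rw [pow_zero] at h
    exact h
  have hy := he n 𝔓 h𝔓 τ hτ
  rcases le_total (e 0) (e n) with h0n | hn0
  · -- `y = x ^ ℓ^{(e n - e 0)}` and `‖y - 1‖ = ‖x - 1‖`
    have hxy : ((χ τ ^ ((ℓ - 1) * ℓ ^ e n) : (PadicAlgCl p)ˣ) : PadicAlgCl p) =
        ((χ τ ^ ((ℓ - 1) * ℓ ^ e 0) : (PadicAlgCl p)ˣ) : PadicAlgCl p) ^ ℓ ^ (e n - e 0) := by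
      rw [← Units.val_pow_eq_pow_val, ← pow_mul, mul_assoc, ← pow_add, Nat.add_sub_cancel' h0n]
    rw [hxy, norm_pow_sub_one_eq hx0 (hpℓ _)] at hy
    exact hy
  · -- `x = y ^ ℓ^{(e 0 - e n)}` and `‖y^j - 1‖ ≤ ‖y - 1‖`
    have hyx : ((χ τ ^ ((ℓ - 1) * ℓ ^ e 0) : (PadicAlgCl p)ˣ) : PadicAlgCl p) =
        ((χ τ ^ ((ℓ - 1) * ℓ ^ e n) : (PadicAlgCl p)ˣ) : PadicAlgCl p) ^ ℓ ^ (e 0 - e n) := by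
      rw [← Units.val_pow_eq_pow_val, ← pow_mul, mul_assoc, ← pow_add, Nat.add_sub_cancel' hn0]
    have hy0 : ‖((χ τ ^ ((ℓ - 1) * ℓ ^ e n) : (PadicAlgCl p)ˣ) : PadicAlgCl p) - 1‖ < 1 :=
      lt_of_lt_of_le hy (pow_le_one₀ (by norm_num) (by norm_num))
    rw [hyx]
    exact lt_of_le_of_lt (norm_pow_sub_one_le hy0 _) hy

end Character

end Summit.Langlands.Langlands.Theorems.EvenSkinnerWilesMirrorDeterminantParity
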